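import Summits.CriticalPhenomena.PercolationContinuityZ3.Theorems.PercNearOneGluingNoHeavyPcintMeanMem
import HarnessLib

/-!
# PCINT lane, reduction B3m on the memory-`τ` DANGEROUS-SET automaton — the step factors, off the path and on the path

Cell `prim-pcint` (PAPER-2 track (iii): certified intervals for `p_c(ℤ^d)`), seat `prim-pcint-2` (gen 4); support file
(`--supports stmt-CriticalPhenomena-4575`).  Does NOT build on p205010.  Memo: `run/shared/lean/prim/pcint/REDUCTIONS.md` §B3m.

Three-unit version of `…ThirdMemStep`: the unit factor `s^{cdet-ctu-cmu} t^{ctu} m^{cmu} κ̄^{[bcorner]}` of a B3m step is the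
product of site factors `siteF3 = s^{uA-uAt-uA3} t^{uAt} m^{uA3}` times the corner factor, split as `offF3 · onF3`; the full
B3m weight is a product of time factors `tgapFactor3` (`meanBondWeight_eq_prod`); OFF the path `tgapFactor3 (t+1) ≤ offF3 t`
(`tgapFactor3_le_offF3`, by `pow3_mono` with the unit comparisons `one_add_bcbonus_le_uF`, `one_le_uFt_of_mem_ctSet`,
`one_le_uF3_of_mem_cm3Set`); ON the path `∏_{fibre} chargeF3 ≤ onF3` (`prod_chargeF3_le_onF3`).
-/

noncomputable section

namespace Summit.CriticalPhenomena.PercolationContinuityZ3.Theorems.Pcint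

open Finset Literature.Probability.Percolation Literature.Probability.LatticeModels ChainBond

variable {d : ℕ} (a₀ : Fin d × Bool) {τ kc n : ℕ} {γ : Fin n → Fin d × Bool}

/-! ### The time factors of the B3m weight -/

/-- The full-information three-unit factor of the incidence of `w` at time `T`. [folklore] -/
def tsiteF3 (s tv mv : ℝ) (kc : ℕ) (γ : Fin n → Fin d × Bool) (w : Site d) (T : ℕ) : ℝ :=
  s ^ (uF kc γ w T - uFt kc γ w T - uF3 kc γ w T) * tv ^ uFt kc γ w T * mv ^ uF3 kc γ w T

open Classical in
/-- The full B3m factor of a word at time `T`. [folklore] -/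
def tgapFactor3 (s tv mv : ℝ) (kc : ℕ) (γ : Fin n → Fin d × Bool) (T : ℕ) : ℝ :=
  (∏ w ∈ offSites γ, tsiteF3 s tv mv kc γ w T) * (if 2 ≤ T ∧ IsCorner γ (T - 2) then (1 + s ^ 2) / 2 else 1)

section Factors

variable {s tv mv : ℝ} (hs0 : 0 ≤ s) (hs1 : s ≤ 1) (ht0 : 0 ≤ tv) (htm : tv ≤ mv) (hms : mv ≤ s)
include hs0 hs1 ht0 htm hms

omit hs1 hms in
/-- Site factors are nonnegative. [folklore] -/
theorem tsiteF3_nonneg (kc : ℕ) (γ : Fin n → Fin d × Bool) (w : Site d) (T : ℕ) : 0 ≤ tsiteF3 s tv mv kc γ w T := by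
  unfold tsiteF3; have := ht0.trans htm; positivity

/-- Site factors are at most one. [folklore] -/
theorem tsiteF3_le_one (kc : ℕ) (γ : Fin n → Fin d × Bool) (w : Site d) (T : ℕ) : tsiteF3 s tv mv kc γ w T ≤ 1 := by
  unfold tsiteF3
  have hm0 := ht0.trans htm
  exact mul_le_one₀ (mul_le_one₀ (pow_le_one₀ hs0 hs1) (pow_nonneg ht0 _) (pow_le_one₀ ht0 ((htm.trans hms).trans hs1)))
    (pow_nonneg hm0 _) (pow_le_one₀ hm0 (hms.trans hs1))

omit hs1 hms in
/-- Time factors are nonnegative. [folklore] -/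
theorem tgapFactor3_nonneg (kc : ℕ) (γ : Fin n → Fin d × Bool) (T : ℕ) : 0 ≤ tgapFactor3 s tv mv kc γ T := by
  classical
  unfold tgapFactor3
  have := prod_nonneg fun w (_ : w ∈ offSites γ) => tsiteF3_nonneg hs0 ht0 htm kc γ w T
  split_ifs <;> positivity

/-- Dropping sites from the product of site factors increases it. [folklore] -/
theorem prod_tsiteF3_le_of_subset (kc : ℕ) (γ : Fin n → Fin d × Bool) (T : ℕ) {J : Finset (Site d)}
    (hJ : J ⊆ offSites γ) : ∏ w ∈ offSites γ, tsiteF3 s tv mv kc γ w T ≤ ∏ w ∈ J, tsiteF3 s tv mv kc γ w T := by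
  classical
  rw [← prod_sdiff hJ]
  exact mul_le_of_le_one_left (prod_nonneg fun w _ => tsiteF3_nonneg hs0 ht0 htm kc γ w T)
    (prod_le_one (fun w _ => tsiteF3_nonneg hs0 ht0 htm kc γ w T) fun w _ => tsiteF3_le_one hs0 hs1 ht0 htm hms kc γ w T)

end Factors

/-- The time-`0` factor is one. [folklore] -/
theorem tgapFactor3_zero (s tv mv : ℝ) (kc : ℕ) (γ : Fin n → Fin d × Bool) : tgapFactor3 s tv mv kc γ 0 = 1 := by
  classical
  unfold tgapFactor3
  rw [if_neg (by omega), mul_one]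
  refine prod_eq_one fun w _ => ?_
  unfold tsiteF3
  have h0 := uF_zero kc γ w
  have h12 := uFt_add_uF3_le kc γ w 0
  have h1 : uFt kc γ w 0 = 0 := by omega
  have h2 : uF3 kc γ w 0 = 0 := by omega
  rw [h0, h1, h2, Nat.sub_zero, pow_zero, pow_zero, pow_zero, mul_one, mul_one]

/-- **The B3m weight as a product of time factors.** [folklore] -/
theorem meanBondWeight_eq_prod (p s tv t' mv : ℝ) (hmv : mv = (tv + t') / 2) (kc : ℕ) (γ : Fin n → Fin d × Bool) :
    meanBondWeight p s tv t' kc γ = p ^ n * (1 - p) ^ (chordEdges γ).card * ∏ T ∈ range (n + 1), tgapFactor3 s tv mv kc γ T := by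
  classical
  unfold meanBondWeight tgapFactor3
  rw [prod_mul_distrib, prod_ite, prod_const_one, mul_one, prod_const, card_filter_corner]
  have hsite : ∏ T ∈ range (n + 1), ∏ w ∈ offSites γ, tsiteF3 s tv mv kc γ w T =
      s ^ s3Total kc γ * tv ^ tTotal kc γ * mv ^ c3Total kc γ := by
    have h1 : ∀ T, ∏ w ∈ offSites γ, tsiteF3 s tv mv kc γ w T =
        s ^ (dunitsAt kc γ T - tunitsAt kc γ T - c3unitsAt kc γ T) * tv ^ tunitsAt kc γ T * mv ^ c3unitsAt kc γ T := by
      intro T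
      have hexp : ∑ w ∈ offSites γ, (uF kc γ w T - uFt kc γ w T - uF3 kc γ w T) =
          dunitsAt kc γ T - tunitsAt kc γ T - c3unitsAt kc γ T := by
        rw [dunitsAt, tunitsAt, c3unitsAt, Nat.sub_sub, ← sum_add_distrib,
          ← sum_tsub_distrib _ (fun w _ => uFt_add_uF3_le kc γ w T)]
        exact sum_congr rfl fun w _ => Nat.sub_sub _ _ _
      unfold tsiteF3
      rw [prod_mul_distrib, prod_mul_distrib, prod_pow_eq_pow_sum, prod_pow_eq_pow_sum, prod_pow_eq_pow_sum, hexp]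
      rfl
    rw [prod_congr rfl (fun T _ => h1 T), prod_mul_distrib, prod_mul_distrib, prod_pow_eq_pow_sum, prod_pow_eq_pow_sum,
      prod_pow_eq_pow_sum, ← s3Total_eq_sum, ← tTotal_eq_sum, ← c3Total_eq_sum]
  rw [hsite, hmv]
  ring

/-! ### The automaton's site factors and the off/on split -/

section Step

open Classical

/-- The automaton's corner-third indicator of a det-paying site. [folklore] -/
def uA3 (kc : ℕ) (S : MState d) (a : Fin d × Bool) (w' : Site d) : ℕ := if w' ∈ cm3Set kc S a then 1 else 0

/-- The automaton's three-unit factor of a det-paying site. [folklore] -/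
def siteF3 (s tv mv : ℝ) (τ kc : ℕ) (S : MState d) (a : Fin d × Bool) (w' : Site d) : ℝ :=
  s ^ (uA τ kc S w' - uAt kc S a w' - uA3 kc S a w') * tv ^ uAt kc S a w' * mv ^ uA3 kc S a w'

/-- `uAt + uA3 ≤ 1 ≤ uA`. [folklore] -/
theorem uAt_add_uA3_le (τ kc : ℕ) (S : MState d) (a : Fin d × Bool) (w' : Site d) :
    uAt kc S a w' + uA3 kc S a w' ≤ 1 ∧ 1 ≤ uA τ kc S w' := by
  unfold uAt uA3 uA
  have hd := cm3Set_disjoint_ctSet kc S a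
  constructor
  · split_ifs with h1 h2
    · exact absurd h2 (disjoint_right.1 hd h1)
    all_goals omega
  · omega

/-- **The unit factor is the product of the site factors.** [folklore] -/
theorem unitFactor_eq_prod3 (s tv mv : ℝ) (τ kc : ℕ) (S : MState d) (a : Fin d × Bool) :
    s ^ (cdet τ kc S a - ctu kc S a - cmu kc S a) * tv ^ ctu kc S a * mv ^ cmu kc S a =
      ∏ w' ∈ cdetSet kc S a, siteF3 s tv mv τ kc S a w' := by
  unfold siteF3
  rw [prod_mul_distrib, prod_mul_distrib, prod_pow_eq_pow_sum, prod_pow_eq_pow_sum, prod_pow_eq_pow_sum]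
  have hT : ∑ w' ∈ cdetSet kc S a, uAt kc S a w' = ctu kc S a := by
    unfold uAt ctu
    rw [sum_boole, Nat.cast_id]
    congr 1; ext w
    simp only [mem_filter, and_iff_right_iff_imp]
    exact fun h => ctSet_subset kc S a h
  have hM : ∑ w' ∈ cdetSet kc S a, uA3 kc S a w' = cmu kc S a := by
    unfold uA3 cmu
    rw [sum_boole, Nat.cast_id]
    congr 1; ext w
    simp only [mem_filter, and_iff_right_iff_imp]
    exact fun h => cm3Set_subset kc S a h
  have hS : ∑ w' ∈ cdetSet kc S a, (uA τ kc S w' - uAt kc S a w' - uA3 kc S a w') = cdet τ kc S a - ctu kc S a - cmu kc S a := by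
    rw [Nat.sub_sub, ← hT, ← hM, ← sum_add_distrib, cdet_eq_sum,
      ← sum_tsub_distrib _ fun w' _ => (uAt_add_uA3_le τ kc S a w').1.trans (uAt_add_uA3_le τ kc S a w').2]
    exact sum_congr rfl fun w _ => by rw [Nat.sub_sub]
  rw [hT, hM, hS]

variable {s tv mv κb : ℝ}

/-- The OFF-PATH part of the B3m step factor. [folklore] -/
def offF3 (s tv mv κb : ℝ) (τ kc : ℕ) (γ : Fin n → Fin d × Bool) (t : ℕ) : ℝ :=
  if ht : t < n then
    (∏ w' ∈ (cdetSet kc (danger τ (pre a₀ γ t)) (γ ⟨t, ht⟩)).filter fun w' => w' + wordPos γ t ∉ pathSites γ,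
        siteF3 s tv mv τ kc (danger τ (pre a₀ γ t)) (γ ⟨t, ht⟩) w') *
      (if bcorner (danger τ (pre a₀ γ t)) (γ ⟨t, ht⟩) = true ∧ cornerSite γ (t - 1) ∉ pathSites γ then κb else 1)
  else 1

/-- The ON-PATH part of the B3m step factor. [folklore] -/
def onF3 (s tv mv κb : ℝ) (τ kc : ℕ) (γ : Fin n → Fin d × Bool) (t : ℕ) : ℝ :=
  if ht : t < n then
    (∏ w' ∈ (cdetSet kc (danger τ (pre a₀ γ t)) (γ ⟨t, ht⟩)).filter fun w' => w' + wordPos γ t ∈ pathSites γ,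
        siteF3 s tv mv τ kc (danger τ (pre a₀ γ t)) (γ ⟨t, ht⟩) w') *
      (if bcorner (danger τ (pre a₀ γ t)) (γ ⟨t, ht⟩) = true ∧ cornerSite γ (t - 1) ∈ pathSites γ then κb else 1)
  else 1

/-- **The step's unit factor splits as `offF3 · onF3`.** [folklore] -/
theorem unitFactor_eq_offF3_mul_onF3 {t : ℕ} (ht : t < n) :
    s ^ (cdet τ kc (danger τ (pre a₀ γ t)) (γ ⟨t, ht⟩) - ctu kc (danger τ (pre a₀ γ t)) (γ ⟨t, ht⟩) -
          cmu kc (danger τ (pre a₀ γ t)) (γ ⟨t, ht⟩)) *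
        tv ^ ctu kc (danger τ (pre a₀ γ t)) (γ ⟨t, ht⟩) * mv ^ cmu kc (danger τ (pre a₀ γ t)) (γ ⟨t, ht⟩) *
        (if bcorner (danger τ (pre a₀ γ t)) (γ ⟨t, ht⟩) then κb else 1) =
      offF3 a₀ s tv mv κb τ kc γ t * onF3 a₀ s tv mv κb τ kc γ t := by
  rw [unitFactor_eq_prod3, offF3, onF3, dif_pos ht, dif_pos ht]
  set D := cdetSet kc (danger τ (pre a₀ γ t)) (γ ⟨t, ht⟩)
  rw [← prod_filter_mul_prod_filter_not D (fun w' => w' + wordPos γ t ∈ pathSites γ)]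
  by_cases hc : bcorner (danger τ (pre a₀ γ t)) (γ ⟨t, ht⟩) = true
  · by_cases hon : cornerSite γ (t - 1) ∈ pathSites γ
    · rw [if_pos hc, if_neg (fun h => h.2 hon), if_pos ⟨hc, hon⟩]; ring
    · rw [if_pos hc, if_pos ⟨hc, hon⟩, if_neg (fun h => hon h.2)]; ring
  · rw [if_neg hc, if_neg (fun h => hc h.1), if_neg (fun h => hc h.1)]; ring

/-- `offF3` is nonnegative. [folklore] -/
theorem offF3_nonneg (hs0 : 0 ≤ s) (ht0 : 0 ≤ tv) (hm0 : 0 ≤ mv) (hκb : 0 ≤ κb) (t : ℕ) :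
    0 ≤ offF3 a₀ s tv mv κb τ kc γ t := by
  unfold offF3 siteF3; split_ifs <;> positivity

/-- `onF3` is nonnegative. [folklore] -/
theorem onF3_nonneg (hs0 : 0 ≤ s) (ht0 : 0 ≤ tv) (hm0 : 0 ≤ mv) (hκb : 0 ≤ κb) (t : ℕ) : 0 ≤ onF3 a₀ s tv mv κb τ kc γ t := by
  unfold onF3 siteF3; split_ifs <;> positivity

/-! ### Off the path: the time factor is dominated -/

/-- **A det-paying site's full-information factor is at most its automaton factor.** [folklore] -/
theorem tsiteF3_le_siteF3 (hτ : kc + 4 ≤ τ) (hkc : 2 ≤ kc) {t : ℕ} (ht : t < n) (hs1 : s ≤ 1) (ht0 : 0 ≤ tv) (htm : tv ≤ mv)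
    (hms : mv ≤ s) {w' : Site d} (hw' : w' ∈ cdetSet kc (danger τ (pre a₀ γ t)) (γ ⟨t, ht⟩)) :
    tsiteF3 s tv mv kc γ (w' + wordPos γ t) (t + 1) ≤ siteF3 s tv mv τ kc (danger τ (pre a₀ γ t)) (γ ⟨t, ht⟩) w' := by
  unfold tsiteF3 siteF3
  set S := danger τ (pre a₀ γ t)
  have hU := one_add_bcbonus_le_uF a₀ hτ ht hw'
  have hUA : uA τ kc S w' ≤ uF kc γ (w' + wordPos γ t) (t + 1) := by unfold uA; exact hU
  have hTA : uAt kc S (γ ⟨t, ht⟩) w' ≤ uFt kc γ (w' + wordPos γ t) (t + 1) := by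
    unfold uAt
    split_ifs with h
    · exact one_le_uFt_of_mem_ctSet a₀ hτ hkc ht h
    · exact Nat.zero_le _
  have h3A : uA3 kc S (γ ⟨t, ht⟩) w' ≤ uF3 kc γ (w' + wordPos γ t) (t + 1) := by
    unfold uA3
    split_ifs with h
    · exact one_le_uF3_of_mem_cm3Set a₀ hkc ht h
    · exact Nat.zero_le _
  have h1 := uFt_add_uF3_le kc γ (w' + wordPos γ t) (t + 1)
  have h2 := (uAt_add_uA3_le τ kc S (γ ⟨t, ht⟩) w')
  exact pow3_mono hs1 ht0 htm hms hTA h3A (by omega)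

/-- **Off-path domination for kind `chordmean`**: `tgapFactor3 (t+1) ≤ offF3 t`. [folklore] -/
theorem tgapFactor3_le_offF3 (hτ : kc + 4 ≤ τ) (hkc : 2 ≤ kc) {t : ℕ} (ht : t < n) (hs0 : 0 ≤ s) (hs1 : s ≤ 1)
    (ht0 : 0 ≤ tv) (htm : tv ≤ mv) (hms : mv ≤ s) (hκb : (1 + s ^ 2) / 2 ≤ κb) :
    tgapFactor3 s tv mv kc γ (t + 1) ≤ offF3 a₀ s tv mv κb τ kc γ t := by
  set S := danger τ (pre a₀ γ t) with hS
  set a := γ ⟨t, ht⟩ with ha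
  set Doff := (cdetSet kc S a).filter fun w' => w' + wordPos γ t ∉ pathSites γ with hDoff
  set I := Doff.image fun w' => w' + wordPos γ t with hI
  have hm0 : 0 ≤ mv := ht0.trans htm
  have hκ0 : 0 ≤ κb := by nlinarith
  have hsκ : s ≤ κb := by nlinarith
  have hIsub : I ⊆ offSites γ := by
    intro w hw
    obtain ⟨w', hw', rfl⟩ := mem_image.1 hw
    obtain ⟨hD, hoff⟩ := mem_filter.1 hw'
    have hn := (mem_filter.1 hD).1
    rw [mem_nbrSites] at hn
    refine mem_offSites.2 ⟨hoff, t + 1, by omega, ?_⟩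
    rw [← adj_sub_wordPos_iff γ t, ← stepVec_eq_sub ht, add_sub_cancel_right]; exact hn
  have hprodI : ∏ w ∈ I, tsiteF3 s tv mv kc γ w (t + 1) ≤ ∏ w' ∈ Doff, siteF3 s tv mv τ kc S a w' := by
    rw [hI, prod_image fun x _ y _ h => add_right_cancel h]
    exact prod_le_prod (fun w' _ => tsiteF3_nonneg hs0 ht0 htm kc γ _ _) fun w' hw' =>
      tsiteF3_le_siteF3 a₀ hτ hkc ht hs1 ht0 htm hms (mem_filter.1 hw').1
  have hprodI0 : 0 ≤ ∏ w ∈ I, tsiteF3 s tv mv kc γ w (t + 1) := prod_nonneg fun w _ => tsiteF3_nonneg hs0 ht0 htm kc γ _ _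
  have hDoff0 : 0 ≤ ∏ w' ∈ Doff, siteF3 s tv mv τ kc S a w' := by unfold siteF3; exact prod_nonneg fun _ _ => by positivity
  rw [offF3, dif_pos ht, tgapFactor3]
  set cornerF : ℝ := (if 2 ≤ t + 1 ∧ IsCorner γ (t + 1 - 2) then (1 + s ^ 2) / 2 else 1) with hcornerF
  have hcf0 : 0 ≤ cornerF := by rw [hcornerF]; split_ifs <;> positivity
  have hcf1 : cornerF ≤ 1 := by rw [hcornerF]; split_ifs <;> nlinarith
  by_cases hc : bcorner S a = true
  · obtain ⟨ht1, -⟩ := bcorner_spec a₀ ht hc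
    by_cases hon : cornerSite γ (t - 1) ∈ pathSites γ
    · rw [if_neg (fun h => h.2 hon)]
      have hnc : ¬ (2 ≤ t + 1 ∧ IsCorner γ (t + 1 - 2)) := by
        rintro ⟨-, hcor⟩
        rw [show t + 1 - 2 = t - 1 by omega] at hcor
        obtain ⟨_, _, hoffc, _⟩ := hcor
        exact hoffc hon
      rw [hcornerF, if_neg hnc, mul_one, mul_one]
      exact (prod_tsiteF3_le_of_subset hs0 hs1 ht0 htm hms kc γ _ hIsub).trans hprodI
    · rw [if_pos ⟨hc, hon⟩]
      by_cases hgc : IsCorner γ (t - 1)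
      · have hcf : cornerF ≤ κb := by
          rw [hcornerF, if_pos ⟨by omega, by rw [show t + 1 - 2 = t - 1 by omega]; exact hgc⟩]; exact hκb
        exact mul_le_mul ((prod_tsiteF3_le_of_subset hs0 hs1 ht0 htm hms kc γ _ hIsub).trans hprodI) hcf hcf0 hDoff0
      · obtain ⟨huF, hnotD⟩ := one_le_uF_cornerSite a₀ hkc ht hc hon hgc
        have hCnot : cornerSite γ (t - 1) ∉ I := by
          intro hC
          obtain ⟨w', hw', hwC⟩ := mem_image.1 hC
          apply hnotD
          rw [show cornerSite γ (t - 1) - wordPos γ t = w' by rw [← hwC, add_sub_cancel_right]]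
          exact (mem_filter.1 hw').1
        have hCoffS : cornerSite γ (t - 1) ∈ offSites γ := by
          obtain ⟨_, -, -, hC1, -⟩ := bcorner_spec a₀ ht hc
          exact mem_offSites.2 ⟨hon, t + 1, by omega, hC1⟩
        have hCfac : tsiteF3 s tv mv kc γ (cornerSite γ (t - 1)) (t + 1) ≤ s := by
          unfold tsiteF3
          have h1 := uFt_add_uF3_le kc γ (cornerSite γ (t - 1)) (t + 1)
          have := pow3_mono (a := 1) (b := 0) (c := 0) hs1 ht0 htm hms
            (Nat.zero_le (uFt kc γ (cornerSite γ (t - 1)) (t + 1))) (Nat.zero_le (uF3 kc γ (cornerSite γ (t - 1)) (t + 1)))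
            (by omega : 1 + 0 + 0 ≤ uF kc γ (cornerSite γ (t - 1)) (t + 1) - uFt kc γ (cornerSite γ (t - 1)) (t + 1) -
              uF3 kc γ (cornerSite γ (t - 1)) (t + 1) + uFt kc γ (cornerSite γ (t - 1)) (t + 1) +
              uF3 kc γ (cornerSite γ (t - 1)) (t + 1))
          simpa using this
        have hnc : ¬ (2 ≤ t + 1 ∧ IsCorner γ (t + 1 - 2)) := by
          rintro ⟨-, hcor⟩
          rw [show t + 1 - 2 = t - 1 by omega] at hcor
          exact hgc hcor
        rw [hcornerF, if_neg hnc, mul_one]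
        calc ∏ w ∈ offSites γ, tsiteF3 s tv mv kc γ w (t + 1)
            ≤ ∏ w ∈ insert (cornerSite γ (t - 1)) I, tsiteF3 s tv mv kc γ w (t + 1) :=
              prod_tsiteF3_le_of_subset hs0 hs1 ht0 htm hms kc γ _ (insert_subset hCoffS hIsub)
          _ = tsiteF3 s tv mv kc γ (cornerSite γ (t - 1)) (t + 1) * ∏ w ∈ I, tsiteF3 s tv mv kc γ w (t + 1) := prod_insert hCnot
          _ ≤ s * ∏ w' ∈ Doff, siteF3 s tv mv τ kc S a w' := mul_le_mul hCfac hprodI hprodI0 hs0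
          _ ≤ κb * ∏ w' ∈ Doff, siteF3 s tv mv τ kc S a w' := mul_le_mul_of_nonneg_right hsκ hDoff0
          _ = _ := mul_comm _ _
  · rw [if_neg (fun h => hc h.1), mul_one]
    calc (∏ w ∈ offSites γ, tsiteF3 s tv mv kc γ w (t + 1)) * cornerF
        ≤ (∏ w' ∈ Doff, siteF3 s tv mv τ kc S a w') * 1 :=
          mul_le_mul ((prod_tsiteF3_le_of_subset hs0 hs1 ht0 htm hms kc γ _ hIsub).trans hprodI) hcf1 hcf0 hDoff0
      _ = _ := mul_one _

end Step

end Summit.CriticalPhenomena.PercolationContinuityZ3.Theorems.Pcint
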